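import Literature.Geometry.Kaehler.DeformationEquivalence
import Literature.Geometry.Kaehler.Kaehler
import Literature.Geometry.Kaehler.HolomorphicMapSmooth
import Literature.Geometry.Manifold.ProperSubmersionLocalTrivialisationTranslate
import Literature.AlgebraicTopology.SingularHomology.CohomologyHomotopyInvariance
import HarnessLib

/-!
# Neighbouring fibres of a proper holomorphic submersion are homeomorphic, equivariantly on cohomology for fibre-preserving maps (Ehresmann + homotopy invariance; PROVED)

Layer `Literature/Geometry/Kaehler` (carriers `IsProperHolomorphicSubmersion`, `IsFibreEmbedding` of
`DeformationEquivalence`).  Cell `hodge-kum4` (ladder HodgeAV, rung H3), tranche LT-H3, director-hodge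
g7 2026-08-27T06:36:46Z item (4): the «one cohomology-local-system (Ehresmann)» input of the
transport statement `T₄`, as a THEOREM of the tree (no named fact): Ehresmann's theorem is PROVED in
the tree in the local `C^∞` form with base coordinate and translation law
(`Geometry.Manifold.exists_localTrivialisation_translate`, Bröcker–Jänich (8.12) / Kodaira Thm. 2.5 /
Voisin I Thm. 9.3, Prop. 9.5), and singular cohomology is homotopy invariant
(`singularCohomology.map_eq_of_homotopic'`, Hatcher §3.1).  From these:

* `IsProperHolomorphicSubmersion.exists_realLocalTrivialisation` — the real `C^∞` local
  trivialisation of a proper holomorphic submersion `π : 𝒳 → B` of complex manifolds near a fibre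
  (the complex structures read as real ones: `isManifold_real_of_isManifold_complex`,
  `contMDiff_real_of_mdifferentiable`, restriction of scalars of `dπ`);
* `exists_homeomorph_of_embeddings` — point-set plumbing: mutually inverse ambient maps exchanging
  two embedded copies induce a homeomorphism between the abstract copies;
* **`IsProperHolomorphicSubmersion.exists_nhds_fibreHomeomorph_cohomology`** — for `s₀ ∈ O ⊆ B`
  (`O` open) and an identification `ι₀ : X₀ ≅ π⁻¹(s₀)` there is an open `V`, `s₀ ∈ V ⊆ O`, such that
  every fibre `ι : X ≅ π⁻¹(s)`, `s ∈ V`, comes with a HOMEOMORPHISM `m : X₀ ≃ₜ X` (Kodaira Thm. 2.3: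
  "`M_t` is diffeomorphic to `M_{t₀}`"; here: the flow trivialisation `Tr (τ s, ·)` restricted to
  the fibres) whose pull-back on singular cohomology INTERTWINES the restrictions `h₀`, `h` to the two
  fibres of ANY self-map `F` of `𝒳` continuous and fibre-preserving over `V`:
  `m^* ∘ h^* = h₀^* ∘ m^*` on `Hᵏ(X; R)` (Voisin I §9.2.1: the identifications of the cohomology of
  neighbouring fibres through `H*(𝒳_V)` by restriction — `j_s ∘ m ≃ j_{s₀}` is a homotopy inside
  `𝒳_V = π⁻¹(V)`, `j_s` admits a retraction, and `F` commutes with both; Oguiso 2020 §4: "`g_t^*` is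
  derived from the action of `g̃` on the constant system `⊕ R^k u_* ℤ`").

This is the local, one-chart step of the `Aut°`-equivariant cohomology transport along families
(file `Geometry/Hyperkaehler/AutomorphismsLocalSystemCohomology`); no group, no complex geometry
beyond the submersion is involved.  Universe note: `X₀`, `X`, `𝒳` live in one universe (homotopy
invariance of the tree's singular cohomology is stated that way).  Everything is proved; no named
fact, no definition, no instance, no notation.

References: K. Kodaira, *Complex Manifolds and Deformation of Complex Structures* (2005) §2.3
Thm. 2.3, Thm. 2.5 [`Kodaira2005`]; C. Voisin, *Hodge Theory and Complex Algebraic Geometry I* (2002)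
§9.1.1 Thm. 9.3, Prop. 9.5, §9.2.1 [`VoisinHodgeI2002`]; Th. Bröcker, K. Jänich, *Introduction to
Differential Topology* (1982) (8.12) [`BrockerJanichIDT1982`]; A. Hatcher, *Algebraic Topology* (2002)
§3.1 [`Hatcher2002`]; K. Oguiso, Nagoya Math. J. 239 (2020) §4 [`Oguiso2020CohomologicallyTrivialKummer`].
-/

noncomputable section

open scoped Manifold ContDiff Topology unitInterval
open Function Set Filter
open Literature.Geometry.Manifold
open Literature.AlgebraicTopology.SingularHomology

universe u v

namespace Literature.Geometry.Kaehler

/-! ### Point-set plumbing: homeomorphisms between embedded copies -/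

/-- **Mutually inverse ambient maps exchanging two embedded copies induce a homeomorphism.**  Let
`ι₀ : X₀ → 𝒳`, `ι : X → 𝒳` be embeddings with ranges inside `S`, and `A, A' : 𝒳 → 𝒳` continuous on
`S` with `A(ι₀ X₀) ⊆ ι X`, `A'(ι X) ⊆ ι₀ X₀`, `A' ∘ A = id` on `ι₀ X₀` and `A ∘ A' = id` on `ι X`.  Then
there is `m : X₀ ≃ₜ X` with `ι ∘ m = A ∘ ι₀` and `ι₀ ∘ m⁻¹ = A' ∘ ι` (the point-set step of «`M_t` is
diffeomorphic to `M_{t₀}`» once a trivialisation exchanging the two fibres is given). [cite: Kodaira2005, §2.3 Thm. 2.3] -/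
theorem exists_homeomorph_of_embeddings {X₀ X 𝒳 : Type*} [TopologicalSpace X₀] [TopologicalSpace X]
    [TopologicalSpace 𝒳] {ι₀ : X₀ → 𝒳} {ι : X → 𝒳} (hι₀ : Topology.IsEmbedding ι₀) (hι : Topology.IsEmbedding ι)
    {S : Set 𝒳} (hS₀ : range ι₀ ⊆ S) (hS : range ι ⊆ S) {A A' : 𝒳 → 𝒳}
    (hA : ContinuousOn A S) (hA' : ContinuousOn A' S)
    (hAι₀ : ∀ x₀, A (ι₀ x₀) ∈ range ι) (hA'ι : ∀ x, A' (ι x) ∈ range ι₀)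
    (hA'A : ∀ x₀, A' (A (ι₀ x₀)) = ι₀ x₀) (hAA' : ∀ x, A (A' (ι x)) = ι x) :
    ∃ m : X₀ ≃ₜ X, (∀ x₀, ι (m x₀) = A (ι₀ x₀)) ∧ ∀ x, ι₀ (m.symm x) = A' (ι x) := by
  -- the two maps through the homeomorphisms onto the ranges
  have hcA : Continuous fun x₀ ↦ A (ι₀ x₀) :=
    hA.comp_continuous hι₀.continuous fun x₀ ↦ hS₀ (mem_range_self x₀)
  have hcA' : Continuous fun x ↦ A' (ι x) :=
    hA'.comp_continuous hι.continuous fun x ↦ hS (mem_range_self x)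
  let f : X₀ → X := fun x₀ ↦ hι.toHomeomorph.symm ⟨A (ι₀ x₀), hAι₀ x₀⟩
  let f' : X → X₀ := fun x ↦ hι₀.toHomeomorph.symm ⟨A' (ι x), hA'ι x⟩
  have hf : ∀ x₀, ι (f x₀) = A (ι₀ x₀) := fun x₀ ↦ by
    have h := congrArg Subtype.val (hι.toHomeomorph.apply_symm_apply ⟨A (ι₀ x₀), hAι₀ x₀⟩)
    rwa [Topology.IsEmbedding.toHomeomorph_apply_coe] at h
  have hf' : ∀ x, ι₀ (f' x) = A' (ι x) := fun x ↦ by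
    have h := congrArg Subtype.val (hι₀.toHomeomorph.apply_symm_apply ⟨A' (ι x), hA'ι x⟩)
    rwa [Topology.IsEmbedding.toHomeomorph_apply_coe] at h
  refine ⟨⟨⟨f, f', ?_, ?_⟩, ?_, ?_⟩, hf, hf'⟩
  · intro x₀
    apply hι₀.injective
    rw [hf', hf, hA'A]
  · intro x
    apply hι.injective
    rw [hf, hf', hAA']
  · exact hι.toHomeomorph.symm.continuous.comp (hcA.subtype_mk _)
  · exact hι₀.toHomeomorph.symm.continuous.comp (hcA'.subtype_mk _)

/-! ### Ehresmann for a proper holomorphic submersion (real form of the tree's theorem) -/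

section Family

variable {E𝒳 : Type u} [NormedAddCommGroup E𝒳] [NormedSpace ℂ E𝒳] [FiniteDimensional ℂ E𝒳]
  {𝒳 : Type u} [TopologicalSpace 𝒳] [ChartedSpace E𝒳 𝒳] [IsManifold 𝓘(ℂ, E𝒳) ω 𝒳]
  [T2Space 𝒳] [SecondCountableTopology 𝒳]
  {EB : Type u} [NormedAddCommGroup EB] [NormedSpace ℂ EB] [FiniteDimensional ℂ EB]
  {B : Type u} [TopologicalSpace B] [ChartedSpace EB B] [IsManifold 𝓘(ℂ, EB) ω B]
  {π : 𝒳 → B}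

omit [FiniteDimensional ℂ E𝒳] [IsManifold 𝓘(ℂ, E𝒳) ω 𝒳] [T2Space 𝒳] [SecondCountableTopology 𝒳]
  [FiniteDimensional ℂ EB] [IsManifold 𝓘(ℂ, EB) ω B] in
/-- The real differential of a holomorphic submersion is onto (it is the complex differential with
scalars restricted; same charts). [cite: VoisinHodgeI2002, §2.2.1] -/
theorem IsProperHolomorphicSubmersion.surjective_mfderiv_real (hπ : IsProperHolomorphicSubmersion E𝒳 EB π)
    (x : 𝒳) : Surjective (mfderiv 𝓘(ℝ, E𝒳) 𝓘(ℝ, EB) π x) := by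
  have hd : MDifferentiableAt 𝓘(ℂ, E𝒳) 𝓘(ℂ, EB) π x := hπ.contMDiff.mdifferentiableAt (by simp)
  have h := hd.hasMFDerivAt
  have hℝ : HasMFDerivAt 𝓘(ℝ, E𝒳) 𝓘(ℝ, EB) π x
      ((mfderiv 𝓘(ℂ, E𝒳) 𝓘(ℂ, EB) π x : E𝒳 →L[ℂ] EB).restrictScalars ℝ) := by
    refine ⟨h.1, ?_⟩
    have h2 := h.2.restrictScalars ℝ
    rw [ModelWithCorners.Boundaryless.range_eq_univ] at h2 ⊢
    exact h2
  rw [hℝ.mfderiv]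
  intro w
  obtain ⟨v, hv⟩ := hπ.surjective_mfderiv x w
  exact ⟨v, hv⟩

/-- **Ehresmann's local trivialisation for a proper holomorphic submersion** (the tree's PROVED
`Geometry.Manifold.exists_localTrivialisation_translate` applied to the underlying real `C^∞`
structures): near the fibre over `s₀ ∈ O` there are an open `V ∋ s₀`, `V ⊆ O`, the tube
`W = π⁻¹(V)`, a base coordinate `τ : B → ℝᵈ` injective on `V` with `τ s₀ = 0`, and jointly continuous,
`W`-preserving, mutually inverse maps `Tr, Sr : ℝᵈ × 𝒳 → 𝒳` with `Tr (0, ·) = id` on `W` and the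
translation law `τ (π (Tr (u, y))) = τ (π y) + u`. [cite: Kodaira2005, §2.3 Thm. 2.5]
[cite: VoisinHodgeI2002, §9.1.1 Thm. 9.3 and Prop. 9.5] [cite: BrockerJanichIDT1982, (8.12)] -/
theorem IsProperHolomorphicSubmersion.exists_realLocalTrivialisation
    (hπ : IsProperHolomorphicSubmersion E𝒳 EB π) {s₀ : B} {O : Set B} (hO : IsOpen O) (hs₀ : s₀ ∈ O) :
    ∃ (V : Set B) (W : Set 𝒳) (τ : B → EuclideanSpace ℝ (Fin (Module.finrank ℝ EB)))
      (Tr Sr : EuclideanSpace ℝ (Fin (Module.finrank ℝ EB)) × 𝒳 → 𝒳),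
      IsOpen V ∧ s₀ ∈ V ∧ V ⊆ O ∧ W = π ⁻¹' V ∧ ContinuousOn τ V ∧ InjOn τ V ∧ τ s₀ = 0 ∧
      ContinuousOn Tr (univ ×ˢ W) ∧ ContinuousOn Sr (univ ×ˢ W) ∧
      (∀ u, ∀ y ∈ W, Tr (u, y) ∈ W) ∧ (∀ u, ∀ y ∈ W, Sr (u, y) ∈ W) ∧
      (∀ u, ∀ y ∈ W, Sr (u, Tr (u, y)) = y) ∧ (∀ u, ∀ y ∈ W, Tr (u, Sr (u, y)) = y) ∧
      (∀ y ∈ W, Tr (0, y) = y) ∧ ∀ u, ∀ y ∈ W, τ (π (Tr (u, y))) = τ (π y) + u := by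
  haveI : IsManifold 𝓘(ℝ, E𝒳) ∞ 𝒳 := isManifold_real_of_isManifold_complex
  haveI : IsManifold 𝓘(ℝ, EB) ∞ B := isManifold_real_of_isManifold_complex
  have hπℝ : ContMDiff 𝓘(ℝ, E𝒳) 𝓘(ℝ, EB) ∞ π :=
    contMDiff_real_of_mdifferentiable (hπ.contMDiff.mdifferentiable (by simp))
  have hsub : ∀ x, π x ∈ O → Surjective (mfderiv 𝓘(ℝ, E𝒳) 𝓘(ℝ, EB) π x) :=
    fun x _ ↦ hπ.surjective_mfderiv_real x
  have hprop : ∀ K ⊆ O, IsCompact K → IsCompact (π ⁻¹' K) :=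
    fun K _ hK ↦ hπ.isProperMap.isCompact_preimage hK
  obtain ⟨V, W, τ, Tr, Sr, hVo, hs₀V, hVO, -, hW, hτ, hτinj, hτ₀, hTr, hSr, hTrW, hSrW, hSrTr, hTrSr,
    hTr0, hlaw⟩ :=
    Literature.Geometry.Manifold.exists_localTrivialisation_translate (IT := 𝓘(ℝ, E𝒳)) hπℝ hO hs₀ hsub hprop
  exact ⟨V, W, τ, Tr, Sr, hVo, hs₀V, hVO, hW, hτ.continuousOn, hτinj, hτ₀, hTr.continuousOn,
    hSr.continuousOn, hTrW, hSrW, hSrTr, hTrSr, hTr0, hlaw⟩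

/-! ### Neighbouring fibres: homeomorphic, equivariantly on cohomology -/

/-- **Neighbouring fibres of a proper holomorphic submersion are homeomorphic, equivariantly on
cohomology for fibre-preserving maps.**  Let `π : 𝒳 → B` be a proper holomorphic submersion of
complex manifolds (`𝒳` Hausdorff, second countable), `s₀ ∈ O ⊆ B` with `O` open, and
`ι₀ : X₀ → 𝒳` a closed embedding onto `π⁻¹(s₀)`.  There is an open `V` with `s₀ ∈ V ⊆ O` such that
for every `s ∈ V` and every closed embedding `ι : X → 𝒳` onto `π⁻¹(s)` there is a homeomorphism
`m : X₀ ≃ₜ X` with the following property: for every `F : 𝒳 → 𝒳` continuous on `π⁻¹(V)` and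
fibre-preserving there (`π ∘ F = π`), and all continuous `h₀ : X₀ → X₀`, `h : X → X` with
`F ∘ ι₀ = ι₀ ∘ h₀`, `F ∘ ι = ι ∘ h`, the pull-backs satisfy `m^* (h^* c) = h₀^* (m^* c)` for every
`c ∈ Hᵏ(X; R)` (Kodaira Thm. 2.3/2.5: `m` is the flow trivialisation restricted to the fibres;
Voisin I §9.2.1: both `h^*` and `h₀^*` are read off `F^*` on `H*(π⁻¹V)` through the restrictions,
`j_s ∘ m` being homotopic to `j_{s₀}` and `j_s` having a continuous retraction).
[cite: Kodaira2005, §2.3 Thm. 2.3 and Thm. 2.5] [cite: VoisinHodgeI2002, §9.1.1 Thm. 9.3 and §9.2.1]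
[cite: Hatcher2002, §3.1 (homotopy invariance)] [cite: Oguiso2020CohomologicallyTrivialKummer, §4 (proof of Thm. 1.3)] -/
theorem IsProperHolomorphicSubmersion.exists_nhds_fibreHomeomorph_cohomology
    (hπ : IsProperHolomorphicSubmersion E𝒳 EB π) {s₀ : B} {O : Set B} (hO : IsOpen O) (hs₀ : s₀ ∈ O)
    {X₀ : Type u} [TopologicalSpace X₀] {ι₀ : X₀ → 𝒳} (hι₀ : Topology.IsClosedEmbedding ι₀)
    (hι₀r : range ι₀ = π ⁻¹' {s₀}) :
    ∃ V : Set B, IsOpen V ∧ s₀ ∈ V ∧ V ⊆ O ∧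
      ∀ s ∈ V, ∀ ⦃X : Type u⦄ [TopologicalSpace X] ⦃ι : X → 𝒳⦄, Topology.IsClosedEmbedding ι →
        range ι = π ⁻¹' {s} →
        ∃ m : X₀ ≃ₜ X, ∀ (F : 𝒳 → 𝒳), ContinuousOn F (π ⁻¹' V) → (∀ y ∈ π ⁻¹' V, π (F y) = π y) →
          ∀ (h₀ : C(X₀, X₀)) (h : C(X, X)), (∀ x, F (ι₀ x) = ι₀ (h₀ x)) → (∀ x, F (ι x) = ι (h x)) →
            ∀ (R : Type v) [CommRing R] (k : ℕ) (c : singularCohomology R R X k),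
              singularCohomology.map R R (m : C(X₀, X)) k (singularCohomology.map R R h k c) =
                singularCohomology.map R R h₀ k (singularCohomology.map R R (m : C(X₀, X)) k c) := by
  classical
  obtain ⟨V, W, τ, Tr, Sr, hVo, hs₀V, hVO, hW, hτ, hτinj, hτ₀, hTr, hSr, hTrW, hSrW, hSrTr, hTrSr,
    hTr0, hlaw⟩ := hπ.exists_realLocalTrivialisation hO hs₀
  refine ⟨V, hVo, hs₀V, hVO, fun s hs X _ ι hι hιr ↦ ?_⟩
  -- membership bookkeeping
  have hWV : ∀ {y}, y ∈ W ↔ π y ∈ V := fun {y} ↦ by rw [hW]; rfl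
  have hι₀W : ∀ x₀, ι₀ x₀ ∈ W := fun x₀ ↦ by
    have hx : ι₀ x₀ ∈ π ⁻¹' {s₀} := hι₀r ▸ mem_range_self x₀
    rw [mem_preimage, mem_singleton_iff] at hx
    exact hWV.2 (hx ▸ hs₀V)
  have hιW : ∀ x, ι x ∈ W := fun x ↦ by
    have hx : ι x ∈ π ⁻¹' {s} := hιr ▸ mem_range_self x
    rw [mem_preimage, mem_singleton_iff] at hx
    exact hWV.2 (hx ▸ hs)
  have hπι₀ : ∀ x₀, π (ι₀ x₀) = s₀ := fun x₀ ↦ by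
    have hx : ι₀ x₀ ∈ π ⁻¹' {s₀} := hι₀r ▸ mem_range_self x₀
    simpa using hx
  have hπι : ∀ x, π (ι x) = s := fun x ↦ by
    have hx : ι x ∈ π ⁻¹' {s} := hιr ▸ mem_range_self x
    simpa using hx
  -- the translation law read on the two fibres
  have hTrV : ∀ u, ∀ y ∈ W, π (Tr (u, y)) ∈ V := fun u y hy ↦ hWV.1 (hTrW u y hy)
  have hSrV : ∀ u, ∀ y ∈ W, π (Sr (u, y)) ∈ V := fun u y hy ↦ hWV.1 (hSrW u y hy)
  have key1 : ∀ y ∈ W, π y = s₀ → π (Tr (τ s, y)) = s := fun y hy hys₀ ↦ by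
    have h1 := hlaw (τ s) y hy
    rw [hys₀, hτ₀, zero_add] at h1
    exact hτinj (hTrV _ y hy) hs h1
  have hlawSr : ∀ u, ∀ y ∈ W, τ (π (Sr (u, y))) + u = τ (π y) := fun u y hy ↦ by
    have h1 := hlaw u (Sr (u, y)) (hSrW u y hy)
    rw [hTrSr u y hy] at h1
    exact h1.symm
  have key3 : ∀ y ∈ W, π (Sr (τ (π y), y)) = s₀ := fun y hy ↦ by
    have h1 := hlawSr (τ (π y)) y hy
    have h2 : τ (π (Sr (τ (π y), y))) = τ s₀ := by
      rw [hτ₀]; exact add_eq_right.1 h1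
    exact hτinj (hSrV _ y hy) hs₀V h2
  have key2 : ∀ y ∈ W, π y = s → π (Sr (τ s, y)) = s₀ := fun y hy hys ↦ by
    have h := key3 y hy
    rwa [hys] at h
  -- continuity of the sections `Tr (u, ·)`, `Sr (u, ·)` on `W`
  have hTru : ∀ u, ContinuousOn (fun y ↦ Tr (u, y)) W := fun u ↦
    hTr.comp (continuousOn_const.prodMk continuousOn_id) fun y hy ↦ ⟨mem_univ _, hy⟩
  have hSru : ∀ u, ContinuousOn (fun y ↦ Sr (u, y)) W := fun u ↦
    hSr.comp (continuousOn_const.prodMk continuousOn_id) fun y hy ↦ ⟨mem_univ _, hy⟩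
  -- the homeomorphism `m : X₀ ≃ₜ X`, `ι ∘ m = Tr (τ s, ·) ∘ ι₀`
  obtain ⟨m, hm, hm'⟩ := exists_homeomorph_of_embeddings hι₀.isEmbedding hι.isEmbedding
    (S := W) (by rintro _ ⟨x₀, rfl⟩; exact hι₀W x₀) (by rintro _ ⟨x, rfl⟩; exact hιW x)
    (hTru (τ s)) (hSru (τ s))
    (fun x₀ ↦ by
      rw [hιr, mem_preimage, mem_singleton_iff]
      exact key1 _ (hι₀W x₀) (hπι₀ x₀))
    (fun x ↦ by
      rw [hι₀r, mem_preimage, mem_singleton_iff]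
      exact key2 _ (hιW x) (hπι x))
    (fun x₀ ↦ hSrTr _ _ (hι₀W x₀)) (fun x ↦ hTrSr _ _ (hιW x))
  refine ⟨m, fun F hF hFπ h₀ h hF₀ hFh R _ k c ↦ ?_⟩
  -- the tube `W = π⁻¹ V` as a space, the two fibre inclusions, `F` on the tube, a retraction
  rw [← hW] at hF hFπ
  have hFW : ∀ y ∈ W, F y ∈ W := fun y hy ↦ hWV.2 ((hFπ y hy).symm ▸ hWV.1 hy)
  let j : C(X, W) := ⟨fun x ↦ ⟨ι x, hιW x⟩, hι.continuous.subtype_mk _⟩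
  let j₀ : C(X₀, W) := ⟨fun x ↦ ⟨ι₀ x, hι₀W x⟩, hι₀.continuous.subtype_mk _⟩
  let FW : C(W, W) := ⟨fun y ↦ ⟨F y, hFW y y.2⟩, (hF.restrict).subtype_mk _⟩
  have hgmem : ∀ y : W, Sr (τ (π (y : 𝒳)), y) ∈ range ι₀ := fun y ↦ by
    rw [hι₀r, mem_preimage, mem_singleton_iff]
    exact key3 _ y.2
  have hgc : Continuous fun y : W ↦ Sr (τ (π (y : 𝒳)), y) := by
    refine hSr.comp_continuous ?_ fun y ↦ ⟨mem_univ _, y.2⟩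
    refine Continuous.prodMk ?_ continuous_subtype_val
    exact (hτ.comp hπ.isProperMap.continuous.continuousOn fun y hy ↦ hWV.1 hy).comp_continuous
      continuous_subtype_val fun y ↦ y.2
  let g : C(W, X₀) := ⟨fun y ↦ hι₀.isEmbedding.toHomeomorph.symm ⟨Sr (τ (π (y : 𝒳)), y), hgmem y⟩,
    hι₀.isEmbedding.toHomeomorph.symm.continuous.comp (hgc.subtype_mk _)⟩
  have hg : ∀ y : W, ι₀ (g y) = Sr (τ (π (y : 𝒳)), y) := fun y ↦ by
    have h := congrArg Subtype.val
      (hι₀.isEmbedding.toHomeomorph.apply_symm_apply ⟨Sr (τ (π (y : 𝒳)), y), hgmem y⟩)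
    rwa [Topology.IsEmbedding.toHomeomorph_apply_coe] at h
  let r : C(W, X) := (m : C(X₀, X)).comp g
  -- (e4) `r ∘ j = id`
  have e4 : r.comp j = ContinuousMap.id X := by
    ext x
    apply hι.injective
    change ι (m (g (j x))) = ι x
    rw [hm, hg]
    change Tr (τ s, Sr (τ (π (ι x)), ι x)) = ι x
    rw [hπι, hTrSr _ _ (hιW x)]
  -- (e1), (e2) `F` restricts to `h`, `h₀`
  have e1 : FW.comp j = j.comp h := ContinuousMap.ext fun x ↦ Subtype.ext (hFh x)
  have e2 : FW.comp j₀ = j₀.comp h₀ := ContinuousMap.ext fun x ↦ Subtype.ext (hF₀ x)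
  -- (e3) `j ∘ m ≃ j₀` inside the tube, by the flow
  have hHc : Continuous fun p : I × X₀ ↦ Tr (((p.1 : ℝ)) • τ s, ι₀ p.2) := by
    refine hTr.comp_continuous ?_ fun p ↦ ⟨mem_univ _, hι₀W p.2⟩
    exact ((continuous_subtype_val.comp continuous_fst).smul continuous_const).prodMk
      (hι₀.continuous.comp continuous_snd)
  let H : ContinuousMap.Homotopy j₀ (j.comp (m : C(X₀, X))) :=
    { toFun := fun p ↦ ⟨Tr (((p.1 : ℝ)) • τ s, ι₀ p.2), hTrW _ _ (hι₀W p.2)⟩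
      continuous_toFun := hHc.subtype_mk _
      map_zero_left := fun x₀ ↦ by
        apply Subtype.ext
        change Tr (((0 : I) : ℝ) • τ s, ι₀ x₀) = ι₀ x₀
        rw [Icc.coe_zero, zero_smul, hTr0 _ (hι₀W x₀)]
      map_one_left := fun x₀ ↦ by
        apply Subtype.ext
        change Tr (((1 : I) : ℝ) • τ s, ι₀ x₀) = ι (m x₀)
        rw [Icc.coe_one, one_smul, hm] }
  have e3 : j₀.Homotopic (j.comp (m : C(X₀, X))) := ⟨H⟩
  -- the cohomology chase
  have hmaps := singularCohomology.map_eq_of_homotopic' R R e3 k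
  have hc : singularCohomology.map R R j k (singularCohomology.map R R r k c) = c := by
    rw [← ModuleCat.comp_apply, ← singularCohomology.map_comp, e4, singularCohomology.map_id,
      ModuleCat.id_apply]
  set d := singularCohomology.map R R r k c with hd
  have step1 : singularCohomology.map R R h k c =
      singularCohomology.map R R j k (singularCohomology.map R R FW k d) := by
    rw [← hc, ← ModuleCat.comp_apply, ← singularCohomology.map_comp, ← e1,
      singularCohomology.map_comp, ModuleCat.comp_apply]
  have step2 : ∀ x : singularCohomology R R W k,
      singularCohomology.map R R (m : C(X₀, X)) k (singularCohomology.map R R j k x) =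
        singularCohomology.map R R j₀ k x := fun x ↦ by
    rw [← ModuleCat.comp_apply, ← singularCohomology.map_comp, ← hmaps]
  rw [step1, step2, ← ModuleCat.comp_apply, ← singularCohomology.map_comp, e2,
    singularCohomology.map_comp, ModuleCat.comp_apply, ← step2, hc]

end Family

end Literature.Geometry.Kaehler

end
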